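import Summits.AnomalousDissipation.AnomalousDissipation.Theorems.SolenoidalFractalHomogenisationLagrangianStepSidebandLadderCrushParam
import HarnessLib

/-!
# K1L_D `stub_D1_V0thg` (stmt-AnomalousDissipation-27980), R3′ lane «SidebandTailCrushing» — file F4h∘F5 (ii): the LADDER CRUSH with the
# hypocoercivity parameter `b` and the odd balance `q` CHOSEN — two environmental conditions left (odd-viscosity feasibility, box radius)

Helper file of route `SolenoidalFractalHomogenisation` (`--supports stmt-AnomalousDissipation-27980 --as helper`; one-generation hand
`leafhand-ad-solenoidalfractalh-1` g0, road E-c of the planner's FINAL HANDOFF).  `ladder_crush_choice`: in the setting of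
`Sideband.ladder_crush_param` choose `b := (Gm·lo₁/(2S²GM²))^{1/3}` (so that (Q3) `2S²b³GM² ≤ Gm·lo₁` holds with equality) and
`q := 1/√(2S)` (so that (Qc) `16ρq(1+Mo) ≤ 1` and (Qd) `8ρ(1+Mo) ≤ Sq` BOTH reduce to the odd-viscosity FEASIBILITY condition
`128(ρ(1+Mo))² ≤ S` of `LadderCrush.hypocoercive_parameters`' docstring — the registry regime `τ ≤ 1/20`, `ρ ≈ 0.6τ`).  What remains as
hypotheses: feasibility (F) and the box-radius condition (Q4) `16bη₀ ≤ 1` (`η₀ ∝ GM·a²/((R−M)lo')`: the truncation radius `R` large), plus the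
free regularisation parameter `ε > 0` of `U₁, U₂`.  Conclusion: `lam = min(lo₁/(6Sb²), lo₁/(6U₂), 1/(6U₃), 2bGm/(3U₁)) > 0` and
`‖u t₁‖² ≤ 3(1 + Sb²/(2δ₁lo₁))·exp(−lam(t₁−t₀−δ₁))·‖u t₀‖²`.  With `lo' = 10ν/11` (`lo₁ ∝ ν`) this `b ∝ ν^{1/3}`; `ε ∝ ν^{1/3}` and
`R − M ≳ ν^{−2/3}` then give `lam ≳ c·ν^{2/3}` (`ladder_crush_nu`, R3′-1 → R3′-2, not here).  No definitions, no sorry.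
NOT a proof of `stub_D1_V0thg`, of K1L_D or of AD; rung F-D1.A0 infrastructure.
-/

set_option linter.dupNamespace false -- single-conjunct summit: `Summit.AnomalousDissipation.AnomalousDissipation.…` is the mandated namespace

noncomputable section

namespace Summit.AnomalousDissipation.AnomalousDissipation.Theorems.SolenoidalFractalHomogenisation.LagrangianStep.Sideband

open Set Complex
open scoped InnerProductSpace
open Literature.Analysis Literature.Analysis.FunctionSpaces Literature.Analysis.FunctionSpaces.Torus
open Literature.Analysis.FluidPDE Literature.Analysis.FluidPDE.Torus Literature.Analysis.FluidPDE.LatticeShear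

variable {k₀ : ℕ}

/-- Odd-viscosity feasibility `128P² ≤ S` (`P ≥ 0`, `S > 0`) gives `16P ≤ √(2S)`. [folklore] -/
theorem sixteen_mul_le_sqrt_of_feasible {P S : ℝ} (hP : 0 ≤ P) (hS : 0 < S) (hF : 128 * P ^ 2 ≤ S) :
    16 * P ≤ Real.sqrt (2 * S) := by
  have h2S : 0 ≤ 2 * S := by positivity
  rw [← Real.sqrt_sq (by positivity : (0:ℝ) ≤ 16 * P)]
  exact Real.sqrt_le_sqrt (by nlinarith)

set_option maxHeartbeats 400000 in -- pre-budgeted (ops-buildfix rule): large statement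
/-- **LADDER CRUSH WITH `b` AND `q` CHOSEN** (`Sideband.ladder_crush_param` at `b = (Gm·lo₁/(2S²GM²))^{1/3}`, `q = 1/√(2S)`): the four scalar
conditions reduce to the odd-viscosity feasibility `128(ρ(1+Mo))² ≤ S` and the box-radius condition `16bη₀ ≤ 1`; the rate
`lam = min(lo₁/(6Sb²), lo₁/(6U₂), 1/(6U₃), 2bGm/(3U₁))` is positive and the hypocoercive decay bound holds (dictionary of the bound
abbreviations as in `ladder_crush_param`). [cite: BedrossianCotiZelati2017, §2 (hypocoercivity, enhanced dissipation)]
[cite: Avron1998OddViscosity, §2 eq. (1)-(2)] -/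
theorem ladder_crush_choice (W₁ : LatticeWord k₀) {R : ℕ} (i : Fin k₀) (z₀ : Fin 3 → ℤ)
    (hhop : ∑ a, (W₁.phase i).e a * (z₀ a : ℝ) ≠ 0) {M : ℝ} (hM : ∀ j, |((W₁.phase i).m j : ℝ)| ≤ M) (hMR : M < R)
    {𝔸 : Torus.Visc4 (Fin 3)} {lo' hi' : ℝ} (h𝔸 : Torus.NearIso 𝔸 lo' hi') (hlo' : 0 < lo') (hhi : 0 < hi') {βo : ℝ} (hoddA : Torus.OddSmall 𝔸 βo)
    (hβo : 0 ≤ βo) {γ₁ : ℝ} (hγ₁ : 0 ≤ γ₁)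
    {u : ℝ → Space R} {t₀ t₁ δ₁ : ℝ} (hδ : 0 < δ₁) (hδt : t₀ + δ₁ ≤ t₁)
    (hu : ∀ t ∈ Icc t₀ t₁, HasDerivAt u (((gen W₁ 𝔸 γ₁ R t).restrictScalars ℝ) (u t)) t)
    (h0 : u t₀ ∈ ladderSub R (ladder z₀ (W₁.phase i).m))
    (hoff : ∀ t ∈ Icc t₀ t₁, ∀ j, j ≠ i → slotEnvelope W₁ j t = 0)
    {Gm GM : ℝ} (hG : ∀ t ∈ Icc t₀ t₁, Gm ≤ slotEnvelope W₁ i t ∧ slotEnvelope W₁ i t ≤ GM) (hGm : 0 < Gm)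
    -- the bound abbreviations (instantiate with `rfl`)
    {a m₂ lo₁ S ρ Mo η₀ U₁ U₂ U₃ b q lam : ℝ} (ha0 : 0 < a)
    (ha : a = 2 * Real.pi * |∑ a, (W₁.phase i).e a * (z₀ a : ℝ)| * ‖slotAmp W₁ i‖)
    (hm₂ : m₂ = freqNormSq (W₁.phase i).m) (hlo₁ : lo₁ = 4 * Real.pi ^ 2 * lo' / 7)
    (hS : S = 4 * (4 * a ^ 2) + 16 * (8 * a ^ 2 * (1 + m₂) * |hi'| / lo') + 1)
    (hρ : ρ = βo / (2 * lo')) (hMo : Mo = 8 * a ^ 2 * (1 + m₂))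
    (hη₀ : η₀ = GM * (2 * a ^ 2 * 3 / (((R : ℝ) - M) * (4 * Real.pi ^ 2 * lo'))))
    {ε : ℝ} (hε : 0 < ε)
    (hU₁ : U₁ = (1 + m₂) / (4 * a ^ 2) * (2 + 2 * a ^ 2 / ε)) (hU₂ : U₂ = (1 + m₂) / (4 * a ^ 2) * (2 * ε))
    (hU₃ : U₃ = (1 + m₂) / (4 * a ^ 2) * (2 * a ^ 2 * 3 / (((R : ℝ) - M) * (4 * Real.pi ^ 2 * lo')) + 4 * a ^ 2 / (4 * Real.pi ^ 2 * lo' * ((R : ℝ) - M) ^ 2)))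
    -- the choices
    (hb : b = (Gm * lo₁ / (2 * S ^ 2 * GM ^ 2)) ^ (1 / 3 : ℝ)) (hq : q = 1 / Real.sqrt (2 * S))
    (hlam : lam = min (lo₁ / (6 * (S * b ^ 2))) (min (lo₁ / (6 * U₂)) (min (1 / (6 * U₃)) (2 * b * Gm / (3 * U₁)))))
    -- the two environmental conditions
    (hF : 128 * (ρ * (1 + Mo)) ^ 2 ≤ S) (Q4 : 16 * b * η₀ ≤ 1) :
    0 < lam ∧ ‖u t₁‖ ^ 2 ≤ 3 * (1 + S * b ^ 2 / (2 * δ₁ * lo₁)) * Real.exp (-(lam * (t₁ - t₀ - δ₁))) * ‖u t₀‖ ^ 2 := by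
  -- positivity of the structural constants
  have hm₂0 : 0 ≤ m₂ := by rw [hm₂]; exact freqNormSq_nonneg _
  have hlo₁0 : 0 < lo₁ := by rw [hlo₁]; positivity
  have hS0 : 0 < S := by rw [hS]; positivity
  have hρ0 : 0 ≤ ρ := by rw [hρ]; positivity
  have hMo0 : 0 ≤ Mo := by rw [hMo]; positivity
  have hP0 : 0 ≤ ρ * (1 + Mo) := by positivity
  have hGM : 0 < GM := by
    have ht₀ : t₀ ∈ Icc t₀ t₁ := ⟨le_rfl, by linarith⟩
    exact hGm.trans_le ((hG t₀ ht₀).1.trans (hG t₀ ht₀).2)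
  have hx0 : 0 ≤ Gm * lo₁ / (2 * S ^ 2 * GM ^ 2) := by positivity
  have hb0 : 0 < b := by rw [hb]; exact Real.rpow_pos_of_pos (by positivity) _
  have hsqrt0 : 0 < Real.sqrt (2 * S) := Real.sqrt_pos.mpr (by positivity)
  have hq0 : 0 < q := by rw [hq]; positivity
  -- (Q3) with equality
  have hb3 : b ^ 3 = Gm * lo₁ / (2 * S ^ 2 * GM ^ 2) := by
    rw [hb, ← Real.rpow_natCast, ← Real.rpow_mul hx0]
    norm_num
  have Q3 : 2 * S ^ 2 * b ^ 3 * GM ^ 2 ≤ Gm * lo₁ := by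
    rw [hb3]
    have hne : 2 * S ^ 2 * GM ^ 2 ≠ 0 := by positivity
    rw [show 2 * S ^ 2 * (Gm * lo₁ / (2 * S ^ 2 * GM ^ 2)) * GM ^ 2 = Gm * lo₁ * (2 * S ^ 2 * GM ^ 2) / (2 * S ^ 2 * GM ^ 2) by ring,
      mul_div_cancel_right₀ _ hne]
  -- (Qc), (Qd) from feasibility
  have h16 : 16 * (ρ * (1 + Mo)) ≤ Real.sqrt (2 * S) := sixteen_mul_le_sqrt_of_feasible hP0 hS0 hF
  have hsq : Real.sqrt (2 * S) * Real.sqrt (2 * S) = 2 * S := Real.mul_self_sqrt (by positivity)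
  have Qc : 16 * ρ * q * (1 + Mo) ≤ 1 := by
    rw [hq]
    have e : 16 * ρ * (1 / Real.sqrt (2 * S)) * (1 + Mo) = 16 * (ρ * (1 + Mo)) / Real.sqrt (2 * S) := by ring
    rw [e, div_le_one hsqrt0]
    exact h16
  have Qd : 8 * ρ * (1 + Mo) ≤ S * q := by
    rw [hq]
    have e : S * (1 / Real.sqrt (2 * S)) = Real.sqrt (2 * S) / 2 := by
      rw [eq_div_iff two_ne_zero, mul_one_div, div_mul_eq_mul_div, div_eq_iff hsqrt0.ne', hsq]
      ring
    rw [e, le_div_iff₀ two_pos]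
    calc 8 * ρ * (1 + Mo) * 2 = 16 * (ρ * (1 + Mo)) := by ring
      _ ≤ Real.sqrt (2 * S) := h16
  exact ladder_crush_param W₁ i z₀ hhop hM hMR h𝔸 hlo' hhi hoddA hβo hγ₁ hδ hδt hu h0 hoff hG hGm ha0 ha hm₂ hlo₁ hS hρ hMo hη₀
    hb0 hq0 hε hU₁ hU₂ hU₃ hlam Q3 Q4 Qc Qd

end Summit.AnomalousDissipation.AnomalousDissipation.Theorems.SolenoidalFractalHomogenisation.LagrangianStep.Sideband

end
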